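import Mathlib
import Summits.ResolutionOfSingularities.ResolutionOfSingularities.Theorems.HomologicalConductorPersistenceKnorrerTransfer
import HarnessLib

/-!
# Crux `Persistence` (stmt-ResolutionOfSingularities-16484) — w44b K-C3 (γ) = K2-upper:
# `z ∉ caᵐ(k[x,y,z,t]/(xy − z³ − t⁴))` and `t ∉ caᵐ(…)` for every `m` and every field `k`

Route `ResolutionOfSingularities/HomologicalConductor`, chain W4.4b (cell `res-hironaka`), crux `Persistence`
(stmt-ResolutionOfSingularities-16484), KILL CANDIDATE K-C3 (CHAIN w44b v13.2 §V13.10), condition **(γ)** of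
res-L1-w44b-tri-1's REFEREE-KC3 (934cc3b7642bc99f): the UPPER-BOUND certificates `z, t ∉ ca(A)`,
`A = k[x,y,z,t]/(x y − z³ − t⁴)` (`E₆`-curve `z³ + t⁴` suspended twice). CUT 2026-08-27T11:14:33Z by
res-L1-w44b-plan-1 («K-C3 (γ) = K2-upper → res-type-010 g7»), typed by res-type-010. OURS; nothing here is a
statement of the manuscript under review (Hironaka 2017) and no statement of that manuscript is used; AI-written,
weaker than expert review. Filed `--supports stmt-ResolutionOfSingularities-16484 --as helper`.

## Content (def-free: every matrix is carried as a variable with its defining equation, instantiated by `rfl`)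

* §1 **U13b — the Knörrer non-membership corollary in RING-HOM form.** My U13 corollary
  `KnorrerTransfer.not_mem_cohomologyAnnihilatorOfDegree_knorrer` is stated for an `S`-ALGEBRA `S′`; the affine
  threefold `k[x,y,z,t]` is not a `k[z,t]`-algebra by instance, so here the same statement is re-assembled for a pair of
  ring maps `ι : S →+* S′`, `π : S′ →+* S` with `π ∘ ι = id`, `π x = π y = 0` (no local instances).
* §2 **The normalisation factorisation of the `(3,4)`-cusp** (plan-1's SPEC, script `L/w44b/u12/run11.py`):
  `Φ = [[z, 0, t²],[t, z, 0],[0, t, z]]` (columns = the relations `z·1 + t·τ`, `z·τ + t·τ²`, `t²·1 + z·τ²` of the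
  normalisation module `Ō = k[τ] = ⟨1, τ, τ²⟩`, `z = −τ⁴`, `t = τ³`), `Ψ = adj Φ = [[z², t³, −z t²],[−z t, z², t³],
  [t², −z t, z²]]`, `Φ Ψ = Ψ Φ = (z³ + t⁴)·1` — over ANY commutative ring.
* §3 **THE CONDUCTOR CRITERION (characteristic-free, no linear algebra).** For ANY ring map `τ : B →+* D` and
  `d : D` with `τ z = −d⁴`, `τ t = d³` (the parametrisation), a certificate `c·1 = G Ψ + Φ E` over `B` forces
  **`τ c ∈ (d⁶)`**: the row `u = (1, d, d²)` kills `τ Φ` (it is the augmentation `coker Φ → Ō`), and column `0` of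
  `τ Ψ` is `(d⁸, d⁷, d⁶)ᵀ`, so `τ c = (u · (τc·1))₀ = ((u τG) · τΨ)₀ ∈ (d⁶)`. In words: a certificate exists only for
  `c` in the CONDUCTOR `𝔠 = τ⁶ k[τ] ∩ C = 𝔪²` of `C = k[z,t]/(z³+t⁴)`; `1, z, t` and every non-zero `k`-combination
  `λ z + μ t` are excluded. The test ring `D` is free (`k[τ]`, `k[τ]_(τ)`, `k⟦τ⟧`), so the same lemma serves the local
  ring `A_𝔪` and the completion once K2c presents them as `S′ ⧸ (f)`.
* §4 **Assembly**: `S′` noetherian, `f = x y − ι(z³ + t⁴) ∈ S′⁰` (carried as `hfe : f = …`), `τ c ∉ (d⁶)` ⇒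
  `ι c ∉ caᵐ(S′ ⧸ (f))` for every `m` (§3 + §1 + res-D-pv-026's LOST criterion p521040).
* §5 **The affine instance** (`x, y, z, t = X 0, X 1, X 2, X 3` of `MvPolynomial (Fin 4) k`, 026's U12 convention;
  `f = X 0 * X 1 - X 2 ^ 3 - X 3 ^ 4`): for every field `k` and every `m`,
  `mk z ∉ caᵐ`, `mk t ∉ caᵐ`, `mk (C λ * z + C μ * t) ∉ caᵐ` for `(λ, μ) ≠ (0,0)`, and `caᵐ ≠ ⊤`.
  NOT claimed (and not excluded by §3, consistently with `𝔠 = 𝔪²`): anything about `z², z t, t², t³` (the KEPT side is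
  print / K2-lower, res-type-011).

References (mechanism only): H. Knörrer, Invent. Math. 88 (1987) 153–164, §2 (the doubled factorisation);
res-L1-w44b-plan-1 CHAIN w44b v13.2 §V13.10 and CUT 11:14:33Z (OURS); res-L1-w44b-tri-1 REFEREE-KC3 (OURS).
-/

noncomputable section

-- single-problem summit: the doubled namespace component `ResolutionOfSingularities` is forced
set_option linter.dupNamespace false

namespace Summit.ResolutionOfSingularities.ResolutionOfSingularities.Theorems.HomologicalConductor.KC3Upper

open Matrix
open Literature.RingTheory.CohomologyAnnihilator
open Summit.ResolutionOfSingularities.ResolutionOfSingularities.Theorems.HomologicalConductor.LostCertificate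
open Summit.ResolutionOfSingularities.ResolutionOfSingularities.Theorems.HomologicalConductor.KnorrerTransfer

universe u v w

/-! ## §1 U13b: the Knörrer transfer and its non-membership corollary for a pair of ring maps `ι ⊣ π` -/

section RingHomForm

variable {S : Type u} {S' : Type v} [CommRing S] [CommRing S']

/-- `π (ι M) = M` entrywise when `π ∘ ι = id`. [folklore] -/
theorem map_map_of_leftInverse {n : Type*} (ι : S →+* S') (π : S' →+* S) (hπ : ∀ s : S, π (ι s) = s)
    (M : Matrix n n S) : (M.map ι).map π = M := by
  ext i j
  simp [hπ]

variable {n : Type*} [Fintype n] [DecidableEq n]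

/-- The doubled pair of `(ι φ, ι ψ)` is a matrix factorisation of `x y − ι h` (both orders), for a ring map
`ι : S → S′` and a matrix factorisation `φ ψ = h·1 = ψ φ` over `S`. [cite: Knorrer1987, §2] -/
theorem knorrer_mul_ringHom (ι : S →+* S') (φ ψ : Matrix n n S) (h : S)
    (hφψ : φ * ψ = h • (1 : Matrix n n S)) (hψφ : ψ * φ = h • (1 : Matrix n n S)) (x y : S')
    {Φ Ψ : Matrix (n ⊕ n) (n ⊕ n) S'}
    (hΦ : Φ = fromBlocks (φ.map ι) (-(x • (1 : Matrix n n S'))) (y • (1 : Matrix n n S')) (-(ψ.map ι)))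
    (hΨ : Ψ = fromBlocks (-(ψ.map ι)) (x • (1 : Matrix n n S')) (-(y • (1 : Matrix n n S'))) (φ.map ι)) :
    Φ * Ψ = (x * y - ι h) • (1 : Matrix (n ⊕ n) (n ⊕ n) S') ∧
      Ψ * Φ = (x * y - ι h) • (1 : Matrix (n ⊕ n) (n ⊕ n) S') := by
  have hφψ' : φ.map ι * ψ.map ι = ι h • (1 : Matrix n n S') := by
    rw [← Matrix.map_mul, hφψ, map_smul_one ι]
  have hψφ' : ψ.map ι * φ.map ι = ι h • (1 : Matrix n n S') := by
    rw [← Matrix.map_mul, hψφ, map_smul_one ι]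
  exact ⟨knorrer_mul _ _ _ hφψ' hψφ' x y hΦ hΨ, knorrer_mul' _ _ _ hφψ' hψφ' x y hΦ hΨ⟩

/-- **Knörrer certificate transfer, ring-hom form**: `π ∘ ι = id`, `π x = π y = 0`; NO certificate
`c·1 = G₀ ψ + φ E₀` over `S` ⇒ NO certificate `(ι c)·1 = G Ψ + Φ E` over `S′` for the doubled pair of
`(ι φ, ι ψ)`. [cite: Knorrer1987, §2] -/
theorem not_exists_knorrer_certificate_ringHom (ι : S →+* S') (π : S' →+* S) (hπ : ∀ s : S, π (ι s) = s)
    (φ ψ : Matrix n n S) (x y : S') (hx : π x = 0) (hy : π y = 0) {Φ Ψ : Matrix (n ⊕ n) (n ⊕ n) S'}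
    (hΦ : Φ = fromBlocks (φ.map ι) (-(x • (1 : Matrix n n S'))) (y • (1 : Matrix n n S')) (-(ψ.map ι)))
    (hΨ : Ψ = fromBlocks (-(ψ.map ι)) (x • (1 : Matrix n n S')) (-(y • (1 : Matrix n n S'))) (φ.map ι))
    (c : S) (hno : ¬ ∃ G₀ E₀ : Matrix n n S, c • (1 : Matrix n n S) = G₀ * ψ + φ * E₀) :
    ¬ ∃ G E : Matrix (n ⊕ n) (n ⊕ n) S', ι c • (1 : Matrix (n ⊕ n) (n ⊕ n) S') = G * Ψ + Φ * E := by
  refine not_exists_knorrer_certificate π (φ.map ι) (ψ.map ι) x y hx hy hΦ hΨ (ι c) ?_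
  rw [hπ, map_map_of_leftInverse ι π hπ, map_map_of_leftInverse ι π hπ]
  exact hno

end RingHomForm

section RingHomLost

variable {S : Type u} {S' : Type v} [CommRing S] [CommRing S']

/-- **U13b — NO small certificate ⇒ `ι c ∉ caᵐ(S′ ⧸ (f))`, `f = x y − ι h`, ring-hom form (OURS · w44b).**
`S′` noetherian; `ι : S → S′`, `π : S′ → S` ring maps with `π ∘ ι = id` and `π x = π y = 0`; `φ ψ = h·1 = ψ φ` over `S`
(`Fin n`-indexed); `f = x y − ι h ∈ S′⁰`. If `c·1 = G₀ ψ + φ E₀` has NO solution over `S`, then the class of `ι c` lies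
outside `caᵐ(S′ ⧸ (f))` for every `m` (doubled pair re-indexed to `Fin (n + n)`, res-D-pv-026's LOST criterion
`LostCertificate.not_mem_cohomologyAnnihilatorOfDegree_of_not_exists_certificate`). [cite: Knorrer1987, §2] -/
theorem not_mem_cohomologyAnnihilatorOfDegree_knorrer_ringHom [IsNoetherianRing S'] (ι : S →+* S')
    (π : S' →+* S) (hπ : ∀ s : S, π (ι s) = s) {n : ℕ} (φ ψ : Matrix (Fin n) (Fin n) S) (h : S)
    (hφψ : φ * ψ = h • (1 : Matrix (Fin n) (Fin n) S)) (hψφ : ψ * φ = h • (1 : Matrix (Fin n) (Fin n) S))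
    (x y : S') (hx : π x = 0) (hy : π y = 0) {f : S'} (hfe : f = x * y - ι h)
    (hf : f ∈ nonZeroDivisors S') (c : S)
    (hno : ¬ ∃ G₀ E₀ : Matrix (Fin n) (Fin n) S, c • (1 : Matrix (Fin n) (Fin n) S) = G₀ * ψ + φ * E₀)
    (m : ℕ) :
    Ideal.Quotient.mk (Ideal.span ({f} : Set S')) (ι c) ∉
      cohomologyAnnihilatorOfDegree (S' ⧸ Ideal.span ({f} : Set S')) m := by
  subst hfe
  set Φ : Matrix (Fin n ⊕ Fin n) (Fin n ⊕ Fin n) S' :=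
    fromBlocks (φ.map ι) (-(x • (1 : Matrix (Fin n) (Fin n) S'))) (y • 1) (-(ψ.map ι)) with hΦ
  set Ψ : Matrix (Fin n ⊕ Fin n) (Fin n ⊕ Fin n) S' :=
    fromBlocks (-(ψ.map ι)) (x • (1 : Matrix (Fin n) (Fin n) S')) (-(y • 1)) (φ.map ι) with hΨ
  obtain ⟨hΦΨ, hΨΦ⟩ := knorrer_mul_ringHom ι φ ψ h hφψ hψφ x y hΦ hΨ
  let e : Fin n ⊕ Fin n ≃ Fin (n + n) := finSumFinEquiv
  let ρ : Matrix (Fin n ⊕ Fin n) (Fin n ⊕ Fin n) S' ≃ₐ[S'] Matrix (Fin (n + n)) (Fin (n + n)) S' :=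
    Matrix.reindexAlgEquiv S' S' e
  have hρ : ∀ M, Matrix.reindex e e M = ρ M := fun M => rfl
  have hΦΨ' : Matrix.reindex e e Φ * Matrix.reindex e e Ψ =
      (x * y - ι h) • (1 : Matrix (Fin (n + n)) (Fin (n + n)) S') := by
    rw [hρ, hρ, ← map_mul, hΦΨ, map_smul, map_one]
  have hΨΦ' : Matrix.reindex e e Ψ * Matrix.reindex e e Φ =
      (x * y - ι h) • (1 : Matrix (Fin (n + n)) (Fin (n + n)) S') := by
    rw [hρ, hρ, ← map_mul, hΨΦ, map_smul, map_one]
  have hdet : (Matrix.reindex e e Φ).det ∈ nonZeroDivisors S' :=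
    det_mem_nonZeroDivisors_of_mul_eq_smul_one hΦΨ' hf
  have hcert : ¬ ∃ G E : Matrix (Fin (n + n)) (Fin (n + n)) S',
      ι c • (1 : Matrix (Fin (n + n)) (Fin (n + n)) S') =
        G * Matrix.reindex e e Ψ + Matrix.reindex e e Φ * E := by
    rw [exists_certificate_reindex_iff]
    exact not_exists_knorrer_certificate_ringHom ι π hπ φ ψ x y hx hy hΦ hΨ c hno
  exact not_mem_cohomologyAnnihilatorOfDegree_of_not_exists_certificate (x * y - ι h) hf
    (Matrix.reindex e e Φ) (Matrix.reindex e e Ψ) hΦΨ' hΨΦ' hdet (ι c) hcert m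

end RingHomLost

/-! ## §2 The normalisation factorisation of the `(3,4)`-cusp `z³ + t⁴` -/

section Cusp

variable {B : Type u} [CommRing B]

/-- **`Φ Ψ = (z³ + t⁴)·1`** for `Φ = [[z, 0, t²],[t, z, 0],[0, t, z]]`, `Ψ = [[z², t³, −z t²],[−z t, z², t³],[t², −z t, z²]]`
(`Ψ = adj Φ`, `det Φ = z³ + t⁴`), over any commutative ring. [OURS · L1 w44b · plan-1 SPEC run11.py] -/
theorem cusp34_mul (z t : B) {Φ Ψ : Matrix (Fin 3) (Fin 3) B}
    (hΦ : Φ = !![z, 0, t ^ 2; t, z, 0; 0, t, z])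
    (hΨ : Ψ = !![z ^ 2, t ^ 3, -(z * t ^ 2); -(z * t), z ^ 2, t ^ 3; t ^ 2, -(z * t), z ^ 2]) :
    Φ * Ψ = (z ^ 3 + t ^ 4) • (1 : Matrix (Fin 3) (Fin 3) B) := by
  subst hΦ hΨ
  rw [Matrix.mul_fin_three, Matrix.one_fin_three]
  ext i j
  fin_cases i <;> fin_cases j <;> simp [Matrix.smul_apply] <;> ring

/-- **`Ψ Φ = (z³ + t⁴)·1`** (second order). [OURS · L1 w44b · plan-1 SPEC run11.py] -/
theorem cusp34_mul' (z t : B) {Φ Ψ : Matrix (Fin 3) (Fin 3) B}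
    (hΦ : Φ = !![z, 0, t ^ 2; t, z, 0; 0, t, z])
    (hΨ : Ψ = !![z ^ 2, t ^ 3, -(z * t ^ 2); -(z * t), z ^ 2, t ^ 3; t ^ 2, -(z * t), z ^ 2]) :
    Ψ * Φ = (z ^ 3 + t ^ 4) • (1 : Matrix (Fin 3) (Fin 3) B) := by
  subst hΦ hΨ
  rw [Matrix.mul_fin_three, Matrix.one_fin_three]
  ext i j
  fin_cases i <;> fin_cases j <;> simp [Matrix.smul_apply] <;> ring

/-! ## §3 The conductor criterion: a certificate for `c` forces `τ c ∈ (d⁶)` whenever `τ z = −d⁴`, `τ t = d³` -/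

variable {D : Type v} [CommRing D]

/-- The augmentation row `u = (1, d, d²)` kills `τ Φ` when `τ z = −d⁴`, `τ t = d³` (`u` is the image of the basis of
`coker Φ` in `Ō = k[τ]` under `τ ↦ d`). [OURS · L1 w44b] -/
theorem augmentation_vecMul_map_cusp34 (τ : B →+* D) (z t : B) (d : D) (hz : τ z = -d ^ 4) (ht : τ t = d ^ 3)
    {Φ : Matrix (Fin 3) (Fin 3) B} (hΦ : Φ = !![z, 0, t ^ 2; t, z, 0; 0, t, z]) :
    ![1, d, d ^ 2] ᵥ* Φ.map τ = 0 := by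
  subst hΦ
  ext j
  fin_cases j <;> simp [Matrix.vecMul, dotProduct, Fin.sum_univ_three, hz, ht] <;> ring

/-- Column `0` of `τ Ψ` is `(d⁸, d⁷, d⁶)ᵀ` when `τ z = −d⁴`, `τ t = d³`. [OURS · L1 w44b] -/
theorem map_cusp34_adj_col_zero (τ : B →+* D) (z t : B) (d : D) (hz : τ z = -d ^ 4) (ht : τ t = d ^ 3)
    {Ψ : Matrix (Fin 3) (Fin 3) B}
    (hΨ : Ψ = !![z ^ 2, t ^ 3, -(z * t ^ 2); -(z * t), z ^ 2, t ^ 3; t ^ 2, -(z * t), z ^ 2]) :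
    (Ψ.map τ) 0 0 = d ^ 8 ∧ (Ψ.map τ) 1 0 = d ^ 7 ∧ (Ψ.map τ) 2 0 = d ^ 6 := by
  subst hΨ
  refine ⟨?_, ?_, ?_⟩ <;> simp [hz, ht] <;> ring

/-- **THE CONDUCTOR CRITERION (OURS · w44b K-C3 (γ)).** Let `τ : B → D` be a ring map and `d : D` with `τ z = −d⁴`,
`τ t = d³`. If `c·1 = G Ψ + Φ E` for the cusp factorisation `(Φ, Ψ)` of `z³ + t⁴` over `B`, then **`τ c ∈ (d⁶)`**:
apply `τ`, multiply on the left by the augmentation row `u = (1, d, d²)` (which kills `τ Φ`) and read coordinate `0`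
(column `0` of `τ Ψ` is `(d⁸, d⁷, d⁶)ᵀ`). Characteristic-free; `D` arbitrary. [OURS · L1 w44b] -/
theorem map_mem_span_pow_six_of_certificate (τ : B →+* D) (z t : B) (d : D) (hz : τ z = -d ^ 4)
    (ht : τ t = d ^ 3) {Φ Ψ : Matrix (Fin 3) (Fin 3) B} (hΦ : Φ = !![z, 0, t ^ 2; t, z, 0; 0, t, z])
    (hΨ : Ψ = !![z ^ 2, t ^ 3, -(z * t ^ 2); -(z * t), z ^ 2, t ^ 3; t ^ 2, -(z * t), z ^ 2]) {c : B}
    {G E : Matrix (Fin 3) (Fin 3) B} (hcert : c • (1 : Matrix (Fin 3) (Fin 3) B) = G * Ψ + Φ * E) :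
    τ c ∈ Ideal.span ({d ^ 6} : Set D) := by
  -- apply `τ` entrywise
  have h1 : τ c • (1 : Matrix (Fin 3) (Fin 3) D) = G.map τ * Ψ.map τ + Φ.map τ * E.map τ := by
    have h := congrArg τ.mapMatrix hcert
    rw [map_add, map_mul, map_mul, RingHom.mapMatrix_apply, RingHom.mapMatrix_apply, RingHom.mapMatrix_apply,
      RingHom.mapMatrix_apply, RingHom.mapMatrix_apply, map_smul_one] at h
    exact h
  -- multiply by the augmentation row and read coordinate `0`
  have h2 : (![1, d, d ^ 2] ᵥ* (τ c • (1 : Matrix (Fin 3) (Fin 3) D))) 0 =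
      (![1, d, d ^ 2] ᵥ* (G.map τ * Ψ.map τ + Φ.map τ * E.map τ)) 0 := by rw [h1]
  rw [Matrix.vecMul_smul, Matrix.vecMul_one, Matrix.vecMul_add, ← Matrix.vecMul_vecMul, ← Matrix.vecMul_vecMul,
    augmentation_vecMul_map_cusp34 τ z t d hz ht hΦ, Matrix.zero_vecMul, add_zero, Pi.smul_apply,
    Matrix.cons_val_zero, smul_eq_mul, mul_one] at h2
  obtain ⟨h00, h10, h20⟩ := map_cusp34_adj_col_zero τ z t d hz ht hΨ
  rw [h2, Matrix.vecMul, dotProduct, Fin.sum_univ_three, h00, h10, h20, Ideal.mem_span_singleton]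
  exact ⟨(![1, d, d ^ 2] ᵥ* G.map τ) 0 * d ^ 2 + (![1, d, d ^ 2] ᵥ* G.map τ) 1 * d +
    (![1, d, d ^ 2] ᵥ* G.map τ) 2, by ring⟩

/-- **No certificate outside the conductor**: if `τ c ∉ (d⁶)` for some ring map `τ` with `τ z = −d⁴`, `τ t = d³`, then
`c·1 = G Ψ + Φ E` has no solution. [OURS · L1 w44b] -/
theorem not_exists_certificate_of_map_not_mem (τ : B →+* D) (z t : B) (d : D) (hz : τ z = -d ^ 4)
    (ht : τ t = d ^ 3) {Φ Ψ : Matrix (Fin 3) (Fin 3) B} (hΦ : Φ = !![z, 0, t ^ 2; t, z, 0; 0, t, z])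
    (hΨ : Ψ = !![z ^ 2, t ^ 3, -(z * t ^ 2); -(z * t), z ^ 2, t ^ 3; t ^ 2, -(z * t), z ^ 2]) {c : B}
    (hc : τ c ∉ Ideal.span ({d ^ 6} : Set D)) :
    ¬ ∃ G E : Matrix (Fin 3) (Fin 3) B, c • (1 : Matrix (Fin 3) (Fin 3) B) = G * Ψ + Φ * E :=
  fun ⟨_, _, h⟩ => hc (map_mem_span_pow_six_of_certificate τ z t d hz ht hΦ hΨ h)

end Cusp

/-! ## §4 Assembly: `τ c ∉ (d⁶)` ⇒ `ι c ∉ caᵐ(S′ ⧸ (x y − ι(z³ + t⁴)))` -/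

section Assembly

variable {S : Type u} {S' : Type v} {D : Type w} [CommRing S] [CommRing S'] [CommRing D]

/-- **K-C3 (γ), general form (OURS · w44b).** `S′` noetherian; ring maps `ι : S → S′`, `π : S′ → S` with `π ∘ ι = id`,
`π x = π y = 0`; `f = x y − ι(z³ + t⁴) ∈ S′⁰`; a test map `τ : S → D` with `τ z = −d⁴`, `τ t = d³`. Then every `c : S`
with `τ c ∉ (d⁶)` has `ι c ∉ caᵐ(S′ ⧸ (f))` for EVERY `m`: §3 gives no certificate for `c` over the cusp factorisation,
§1 (U13b) lifts this through Knörrer's double of `x y − ι(z³+t⁴)` and res-D-pv-026's LOST criterion. The test ring `D`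
is free (`k[τ]` for the affine ring, `k⟦τ⟧` for local / complete presentations). [OURS · L1 w44b] -/
theorem not_mem_cohomologyAnnihilatorOfDegree_of_map_not_mem [IsNoetherianRing S'] (ι : S →+* S')
    (π : S' →+* S) (hπ : ∀ s : S, π (ι s) = s) (τ : S →+* D) (z t : S) (d : D) (hz : τ z = -d ^ 4)
    (ht : τ t = d ^ 3) (x y : S') (hx : π x = 0) (hy : π y = 0) {f : S'}
    (hfe : f = x * y - ι (z ^ 3 + t ^ 4)) (hf : f ∈ nonZeroDivisors S') {c : S}
    (hc : τ c ∉ Ideal.span ({d ^ 6} : Set D)) (m : ℕ) :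
    Ideal.Quotient.mk (Ideal.span ({f} : Set S')) (ι c) ∉
      cohomologyAnnihilatorOfDegree (S' ⧸ Ideal.span ({f} : Set S')) m :=
  not_mem_cohomologyAnnihilatorOfDegree_knorrer_ringHom ι π hπ
    !![z, 0, t ^ 2; t, z, 0; 0, t, z]
    !![z ^ 2, t ^ 3, -(z * t ^ 2); -(z * t), z ^ 2, t ^ 3; t ^ 2, -(z * t), z ^ 2] (z ^ 3 + t ^ 4)
    (cusp34_mul z t rfl rfl) (cusp34_mul' z t rfl rfl) x y hx hy hfe hf c
    (not_exists_certificate_of_map_not_mem τ z t d hz ht rfl rfl hc) m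

end Assembly

/-! ## §5 The affine instance `A = k[x,y,z,t] ⧸ (x y − z³ − t⁴)` -/

section Affine

open MvPolynomial

variable (k : Type u) [Field k]

/-- `x y − z³ − t⁴ ≠ 0` in `k[x,y,z,t]` (evaluate at `(1,1,0,0)`). [folklore] -/
theorem f_ne_zero : (X 0 * X 1 - X 2 ^ 3 - X 3 ^ 4 : MvPolynomial (Fin 4) k) ≠ 0 := by
  intro h
  have h' := congrArg (MvPolynomial.eval (![1, 1, 0, 0] : Fin 4 → k)) h
  simp at h'

/-- `x y − z³ − t⁴ ∈ k[x,y,z,t]⁰`. [folklore] -/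
theorem f_mem_nonZeroDivisors :
    (X 0 * X 1 - X 2 ^ 3 - X 3 ^ 4 : MvPolynomial (Fin 4) k) ∈ nonZeroDivisors (MvPolynomial (Fin 4) k) :=
  mem_nonZeroDivisors_of_ne_zero (f_ne_zero k)

/-- The retraction `π : k[x,y,z,t] → k[z,t]`, `x, y ↦ 0`, `z ↦ z`, `t ↦ t`, is a left inverse of the inclusion
`ι : k[z,t] → k[x,y,z,t]`, `z ↦ X 2`, `t ↦ X 3`. [folklore] -/
theorem retraction_comp_inclusion (s : MvPolynomial (Fin 2) k) :
    (MvPolynomial.aeval (![0, 0, X 0, X 1] : Fin 4 → MvPolynomial (Fin 2) k))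
      ((MvPolynomial.aeval (![X 2, X 3] : Fin 2 → MvPolynomial (Fin 4) k)) s) = s := by
  have h : (MvPolynomial.aeval (![0, 0, X 0, X 1] : Fin 4 → MvPolynomial (Fin 2) k)).comp
      (MvPolynomial.aeval (![X 2, X 3] : Fin 2 → MvPolynomial (Fin 4) k)) = AlgHom.id k _ := by
    refine MvPolynomial.algHom_ext fun i => ?_
    fin_cases i <;> simp
  exact AlgHom.congr_fun h s

/-- In `k[τ]`: a polynomial `−λ τ⁴ + μ τ³` with `(λ, μ) ≠ (0, 0)` is not divisible by `τ⁶`. [folklore] -/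
theorem lin_not_mem_span_X_pow_six (a b : k) (hab : a ≠ 0 ∨ b ≠ 0) :
    (-(Polynomial.C a * Polynomial.X ^ 4) + Polynomial.C b * Polynomial.X ^ 3 : Polynomial k) ∉
      Ideal.span ({Polynomial.X ^ 6} : Set (Polynomial k)) := by
  rw [Ideal.mem_span_singleton, Polynomial.X_pow_dvd_iff]
  intro h
  have h3 := h 3 (by norm_num)
  have h4 := h 4 (by norm_num)
  simp [Polynomial.coeff_X_pow] at h3 h4
  rcases hab with ha | hb
  · exact ha h4
  · exact hb h3

/-- **K-C3 (γ), linear forms (OURS · w44b): for every field `k`, every `(λ, μ) ≠ (0,0)` and every `m`, the class of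
`λ z + μ t` does NOT lie in `caᵐ(k[x,y,z,t] ⧸ (x y − z³ − t⁴))`** — one certificate for all combinations (test map
`z ↦ −τ⁴`, `t ↦ τ³`, `−λ τ⁴ + μ τ³ ∉ (τ⁶)`); no torus-homogeneity lemma is needed for the combinations.
[OURS · L1 w44b] -/
theorem mk_lin_not_mem_cohomologyAnnihilatorOfDegree (a b : k) (hab : a ≠ 0 ∨ b ≠ 0) (m : ℕ) :
    Ideal.Quotient.mk (Ideal.span ({X 0 * X 1 - X 2 ^ 3 - X 3 ^ 4} : Set (MvPolynomial (Fin 4) k)))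
        (C a * X 2 + C b * X 3) ∉
      cohomologyAnnihilatorOfDegree (MvPolynomial (Fin 4) k ⧸
        Ideal.span ({X 0 * X 1 - X 2 ^ 3 - X 3 ^ 4} : Set (MvPolynomial (Fin 4) k))) m := by
  let ι : MvPolynomial (Fin 2) k →ₐ[k] MvPolynomial (Fin 4) k := MvPolynomial.aeval ![X 2, X 3]
  let π : MvPolynomial (Fin 4) k →ₐ[k] MvPolynomial (Fin 2) k := MvPolynomial.aeval ![0, 0, X 0, X 1]
  let τ : MvPolynomial (Fin 2) k →ₐ[k] Polynomial k := MvPolynomial.aeval ![-(Polynomial.X ^ 4), Polynomial.X ^ 3]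
  have hιc : ι.toRingHom (C a * X 0 + C b * X 1) = C a * X 2 + C b * X 3 := by
    simp [ι]
  rw [← hιc]
  refine not_mem_cohomologyAnnihilatorOfDegree_of_map_not_mem ι.toRingHom π.toRingHom
    (retraction_comp_inclusion k) τ.toRingHom (X 0) (X 1) Polynomial.X (by simp [τ]) (by simp [τ]) (X 0) (X 1)
    (by simp [π]) (by simp [π]) ?_ (f_mem_nonZeroDivisors k) ?_ m
  · simp [ι]
    ring
  · have hτ : τ.toRingHom (C a * X 0 + C b * X 1) =
        -(Polynomial.C a * Polynomial.X ^ 4) + Polynomial.C b * Polynomial.X ^ 3 := by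
      simp [τ, Polynomial.algebraMap_eq]
    rw [hτ]
    exact lin_not_mem_span_X_pow_six k a b hab

/-- **K-C3 (γ) for `z` (OURS · w44b): `z̄ ∉ caᵐ(k[x,y,z,t] ⧸ (x y − z³ − t⁴))` for every field `k` and every `m`.**
[OURS · L1 w44b] -/
theorem mk_z_not_mem_cohomologyAnnihilatorOfDegree (m : ℕ) :
    Ideal.Quotient.mk (Ideal.span ({X 0 * X 1 - X 2 ^ 3 - X 3 ^ 4} : Set (MvPolynomial (Fin 4) k))) (X 2) ∉
      cohomologyAnnihilatorOfDegree (MvPolynomial (Fin 4) k ⧸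
        Ideal.span ({X 0 * X 1 - X 2 ^ 3 - X 3 ^ 4} : Set (MvPolynomial (Fin 4) k))) m := by
  have h := mk_lin_not_mem_cohomologyAnnihilatorOfDegree k 1 0 (Or.inl one_ne_zero) m
  simpa using h

/-- **K-C3 (γ) for `t` (OURS · w44b): `t̄ ∉ caᵐ(k[x,y,z,t] ⧸ (x y − z³ − t⁴))` for every field `k` and every `m`.**
[OURS · L1 w44b] -/
theorem mk_t_not_mem_cohomologyAnnihilatorOfDegree (m : ℕ) :
    Ideal.Quotient.mk (Ideal.span ({X 0 * X 1 - X 2 ^ 3 - X 3 ^ 4} : Set (MvPolynomial (Fin 4) k))) (X 3) ∉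
      cohomologyAnnihilatorOfDegree (MvPolynomial (Fin 4) k ⧸
        Ideal.span ({X 0 * X 1 - X 2 ^ 3 - X 3 ^ 4} : Set (MvPolynomial (Fin 4) k))) m := by
  have h := mk_lin_not_mem_cohomologyAnnihilatorOfDegree k 0 1 (Or.inr one_ne_zero) m
  simpa using h

/-- `z ∉ ca(A)` and `t ∉ ca(A)` for the full cohomology annihilator `ca = ⋃ₘ caᵐ`,
`A = k[x,y,z,t] ⧸ (x y − z³ − t⁴)`. [OURS · L1 w44b] -/
theorem mk_z_not_mem_cohomologyAnnihilator_and :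
    Ideal.Quotient.mk (Ideal.span ({X 0 * X 1 - X 2 ^ 3 - X 3 ^ 4} : Set (MvPolynomial (Fin 4) k))) (X 2) ∉
        cohomologyAnnihilator (MvPolynomial (Fin 4) k ⧸
          Ideal.span ({X 0 * X 1 - X 2 ^ 3 - X 3 ^ 4} : Set (MvPolynomial (Fin 4) k))) ∧
      Ideal.Quotient.mk (Ideal.span ({X 0 * X 1 - X 2 ^ 3 - X 3 ^ 4} : Set (MvPolynomial (Fin 4) k))) (X 3) ∉
        cohomologyAnnihilator (MvPolynomial (Fin 4) k ⧸
          Ideal.span ({X 0 * X 1 - X 2 ^ 3 - X 3 ^ 4} : Set (MvPolynomial (Fin 4) k))) := by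
  constructor <;> intro h <;> rw [mem_cohomologyAnnihilator_iff] at h <;> obtain ⟨m, hm⟩ := h
  · exact mk_z_not_mem_cohomologyAnnihilatorOfDegree k m hm
  · exact mk_t_not_mem_cohomologyAnnihilatorOfDegree k m hm

end Affine

end Summit.ResolutionOfSingularities.ResolutionOfSingularities.Theorems.HomologicalConductor.KC3Upper

end
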